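import Literature.AlgebraicGeometry.AbelianSchemes.AbelianSchemeQuotientMulNDescent
import Literature.AlgebraicGeometry.AbelianSchemes.AbelianSchemePolarization
import HarnessLib

/-!
# A morphism `μ` is a homomorphism as soon as `π ≫ μ` is, for a flat surjective homomorphism `π` — e.g. the
# quasi-inverse `μ` of a polarisation `λ` (`λ ≫ μ = [e]`)

Topic `AlgebraicGeometry/AbelianSchemes`; namespaces `Literature.AlgebraicGeometry.AbelianSchemes` (§1, group objects of
`Over S`) and `Literature.AlgebraicGeometry.AbelianSchemes.AbelianSchemeOver(.Polarization)` (§2).  THEOREMS ONLY (no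
definition, no named fact, no instance, no `sorry`).

[MumfordAV1970] §7 Thm. 4 (p. 72): the universal property of the quotient by a finite subgroup — a homomorphism that kills
the kernel of an isogeny `π` factors UNIQUELY through `π`, and the factorisation is a homomorphism; [SGA1] Exp. V §1 / Exp.
VIII (fpqc descent): a flat surjective morphism of schemes is an EPIMORPHISM (Mathlib `Flat.epi_of_flat_of_surjective`, Stacks
02VW), and so are its base changes `π ▷ B`, `B ◁ π` in `Over S` (★ `RelativeSpec.ActionOver.IsGeometricQuotient.epi_whiskerRight`
/ `epi_whiskerLeft`), hence `π ⊗ π`.  Consequently the `η`- and `μ`-clauses of `μ : Y → C` may be checked after composing with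
the epimorphisms `π`, `π ⊗ π` — the cancellation pattern of ★ `isMonHom_homDesc` / ★ `isMonHom_mulNDesc`
(`AbelianSchemeQuotientHomDescent`, `AbelianSchemeQuotientMulNDescent`), here for an ARBITRARY flat surjective homomorphism
`π` instead of the quotient map `ψ : A → A/K`.

* §1 (`π` itself is epi: ★ `RelativeSpec.ActionOver.IsGeometricQuotient.epi_of_flat_left`) **`epi_tensorHom_of_flat_surjective`** (`π ⊗ₘ π` epi),
  **`isMonHom_of_comp_of_flat_surjective`** — for `π : X ⟶ Y` a homomorphism of monoid objects of `Over S` with `π.left`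
  flat and surjective and ANY `μ : Y ⟶ C` into a monoid object: `IsMonHom (π ≫ μ) → IsMonHom μ`;
* §2 (abelian schemes) **`isMonHom_of_comp_eq_mulN`** — a quasi-inverse `μ : B → A` of a flat surjective homomorphism
  `φ : A → B` (`φ ≫ μ = [e]_A`, `A` commutative) is a homomorphism ([MumfordAV1970] §7 Thm. 4 / [GortzWedhorn2023] Prop.
  27.190 «there is an isogeny `g` with `g ∘ f = [n]`»); **`Polarization.isMonHom_quasiInverse`** — the case `φ = λ : A → Â`
  (the cell's (cov-3B) quasi-inverse `μ` of ★ `Polarization.exists_quasiInverse`, whose `[Flat] [Surjective] λ.left` are ★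
  `Polarization.flat_lam_left` / `surjective_lam_left`).

Cell `hodgecm-mathlib` (D-0151), HECKE-LINK socket (B), (B5) road E «transfer `hcov` along the quasi-inverse `μ : Â′ → A′`»
(B-p10 (g10) 2026-08-30T00:09:48Z), brick (B5-E1); prover seat B-p11 (g14).  COUNT-NEUTRAL capital: HC_CM is proved only
modulo the 7 printed citations until rung 0 closes; this file discharges none of them.

## References
* [MumfordAV1970] D. Mumford, *Abelian Varieties* (1970), §7 Thm. 4 (p. 72).
* [GortzWedhorn2023] U. Görtz, T. Wedhorn, *Algebraic Geometry II* (2023), Prop. 27.190, Def./Rem. 27.1 (p. 604).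
* [SGA1] A. Grothendieck, *SGA 1* (LNM 224), Exp. V §1; Exp. VIII Thm. 5.2 (fpqc descent: faithfully flat morphisms are
  effective epimorphisms).
* [StacksProject] The Stacks Project, Tag 02VW (an fpqc covering is a universal effective epimorphism).
-/

set_option autoImplicit false

noncomputable section

universe u

open CategoryTheory CategoryTheory.Limits AlgebraicGeometry MonoidalCategory CartesianMonoidalCategory
open scoped MonObj

namespace Literature.AlgebraicGeometry.AbelianSchemes

/-! ### §1 Monoid objects of `Over S`: `IsMonHom (π ≫ μ) → IsMonHom μ` for `π` flat and surjective -/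

section OverBase

variable {S : Scheme.{u}} {X Y C : Over S} (π : X ⟶ Y)

/-- **`π ⊗ π : X ×_S X → Y ×_S Y` is an epimorphism of `Over S`** when `π.left` is flat and surjective: `π ⊗ₘ π =
(π ▷ X) ≫ (Y ◁ π)` and each whiskering is a base change of `π.left` (★ `IsGeometricQuotient.epi_whiskerRight` /
`epi_whiskerLeft`), hence flat, surjective, epi. [cite: SGA1, Exp. V §1] [cite: StacksProject, Tag 02VW] -/
theorem epi_tensorHom_of_flat_surjective [Flat π.left] [Surjective π.left] : Epi (π ⊗ₘ π) := by
  rw [MonoidalCategory.tensorHom_def]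
  haveI := Literature.AlgebraicGeometry.RelativeSpec.ActionOver.IsGeometricQuotient.epi_whiskerRight π (B := X)
  haveI := Literature.AlgebraicGeometry.RelativeSpec.ActionOver.IsGeometricQuotient.epi_whiskerLeft π (B := Y)
  exact epi_comp _ _

/-- **`g : Y → C` (binder `g`; the `μ` of the prose — `μ` is Mathlib's scoped notation for the multiplication) IS A
HOMOMORPHISM AS SOON AS `π ≫ g` IS, for a homomorphism `π : X → Y` of monoid objects of `Over S`
with `π.left` flat and surjective** ([MumfordAV1970] §7 Thm. 4: the factorisation of a homomorphism through an isogeny is a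
homomorphism).  The unit clause `η_Y ≫ μ = η_C` follows from `η_Y = η_X ≫ π`; the multiplication clause
`m_Y ≫ μ = (μ ⊗ μ) ≫ m_C` is checked after the epimorphism `π ⊗ π` (`epi_tensorHom_of_flat_surjective`):
`(π ⊗ π) ≫ m_Y ≫ μ = m_X ≫ π ≫ μ = ((π ≫ μ) ⊗ (π ≫ μ)) ≫ m_C = (π ⊗ π) ≫ (μ ⊗ μ) ≫ m_C`.  (The cancellation pattern of ★
`isMonHom_homDesc` for an arbitrary flat surjective `π`.) [cite: MumfordAV1970, §7 Thm. 4 (p. 72)] [cite: SGA1, Exp. VIII Thm. 5.2] -/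
theorem isMonHom_of_comp_of_flat_surjective [MonObj X] [MonObj Y] [MonObj C] [IsMonHom π] [Flat π.left]
    [Surjective π.left] (g : Y ⟶ C) (h : IsMonHom (π ≫ g)) : IsMonHom g := by
  haveI := epi_tensorHom_of_flat_surjective π
  refine ⟨?_, ?_⟩
  · rw [← IsMonHom.one_hom π, Category.assoc, IsMonHom.one_hom (π ≫ g)]
  · rw [← cancel_epi (π ⊗ₘ π), ← Category.assoc, ← IsMonHom.mul_hom π, Category.assoc, IsMonHom.mul_hom (π ≫ g),
      ← Category.assoc, tensorHom_comp_tensorHom]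

end OverBase

/-! ### §2 Abelian schemes: quasi-inverses of flat surjective homomorphisms are homomorphisms -/

namespace AbelianSchemeOver

variable {S : Scheme.{u}} {A B : AbelianSchemeOver S}

/-- **A quasi-inverse `μ : B → A` of a flat surjective homomorphism `φ : A → B` of abelian schemes — `φ ≫ μ = [e]_A` — is a
homomorphism** (`A` commutative, so that `[e]_A` is a homomorphism, ★ `isMonHom_mulN`; then
`isMonHom_of_comp_of_flat_surjective`).  [GortzWedhorn2023] Prop. 27.190: «there exists an isogeny `g : Y → X` with
`g ∘ f = [n]_X`»; [MumfordAV1970] §7 Thm. 4. [cite: MumfordAV1970, §7 Thm. 4 (p. 72)] [cite: GortzWedhorn2023, Prop. 27.190] -/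
theorem isMonHom_of_comp_eq_mulN [IsCommMonObj A.X] (φ : A.X ⟶ B.X) [IsMonHom φ] [Flat φ.left] [Surjective φ.left]
    {g : B.X ⟶ A.X} {e : ℕ} (hg : φ ≫ g = A.mulN e) : IsMonHom g := by
  have h : IsMonHom (φ ≫ g) := by rw [hg]; exact A.isMonHom_mulN e
  exact isMonHom_of_comp_of_flat_surjective φ g h

/-- **The quasi-inverse `μ : Â → A` of a polarisation `λ : A → Â` — `λ ≫ μ = [e]_A` — is a HOMOMORPHISM** (the cell's
(cov-3B) `μ` of ★ `Polarization.exists_quasiInverse`, with `[Flat] [Surjective] λ.left` from ★ `Polarization.flat_lam_left` /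
`surjective_lam_left`; `A` commutative, e.g. over a reduced base ★ `isCommMonObj_of_isReduced_base`).
[cite: MumfordAV1970, §7 Thm. 4 (p. 72)] [cite: GortzWedhorn2023, Prop. 27.190] -/
theorem Polarization.isMonHom_quasiInverse {D : A.DualPair} (pol : A.Polarization D) [IsCommMonObj A.X]
    [Flat pol.lam.left] [Surjective pol.lam.left] {g : D.hat.X ⟶ A.X} {e : ℕ} (hg : pol.lam ≫ g = A.mulN e) :
    IsMonHom g :=
  haveI := pol.isMonHom
  isMonHom_of_comp_eq_mulN pol.lam hg

end AbelianSchemeOver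

end Literature.AlgebraicGeometry.AbelianSchemes

end
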